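import Summits.SmoothPoincare4.SmoothPoincare4.Theorems.CongruenceShadowsAgkCor6SufficiencyGeomMarkingDefs

/-!
# Stub `stub_cellBasisTransport` of line `lp-by-sphere-system-surgery` for crux `AgkCor6Sufficiency`
(item stmt-SmoothPoincare4-10894, routes `CongruenceShadows` / `GroupTrisection`; lead reshape r6b)

**Transport of a chart-like cell and its cell basis along a homeomorphism `↥F ≃ₜ Z`.**  Given a
closed subset `F ⊆ X`, a homeomorphism `e : ↥F ≃ₜ Z`, a chart-like `2`-cell `Ψ` of the whole space
`Z` (`IsChartCell univ Ψ OZ`) and a genus-`g` cell basis for it (`CellBasis univ Ψ g`), the cell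
`Ψ' = Subtype.val ∘ e.symm ∘ Ψ` is a chart-like cell in `F` (the open set `O'` of `X` is any open
set cutting out `e ⁻¹' OZ` on the subspace `F`, `isOpen_induced_iff`) carrying a genus-`g` cell
basis: the topological embedding `j = Subtype.val ∘ e.symm : Z → X` carries `Z ∖ Ψ(B(0,1))` onto
`F ∖ Ψ'(B(0,1))` and the circle `Ψ(‖z‖ = 1)` onto `Ψ'(‖z‖ = 1)`, so it induces isomorphisms of the
fundamental groups (`fundamentalGroupEquivOfHomeomorph` of the homeomorphisms onto the images,
`IsEmbedding.homeomorphImage`) commuting with the inclusion-induced maps `inclHomOfSubset`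
(naturality checked on loops, `FundamentalGroup.mapOfEq_apply`); a group isomorphism maps a
generator to a generator and the relation `θ(r_g) = incl t` to `θ'(r_g) = incl' t'`.
Pure point-set topology and functoriality of `π₁` (Hatcher, *Algebraic Topology* (2002), §1.1
p. 34 and Prop. 1.18).  No `sorry`.
-/

set_option linter.dupNamespace false

noncomputable section

open Set Function ContinuousMap Metric
open scoped Manifold ContDiff
open Topology

namespace Summit.SmoothPoincare4.SmoothPoincare4.Cruxes.AgkCor6Sufficiency.LpBySphereSystemSurgery

open Literature.Topology.FourManifolds
open Literature.AlgebraicTopology.FundamentalGroup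
open Literature.AlgebraicTopology.FundamentalGroup.VanKampen
open Literature.AlgebraicTopology.Homotopy

/-- **The maps induced on `π₁` by nested subsets `A ⊆ B` of `Z`, transported along a topological
embedding `j : Z → X`.**  For `z₀ ∈ A ⊆ B ⊆ Z` and sets `A' = j(A) ⊆ B' = j(B)` of `X` there are
isomorphisms `θ_A : π₁(↥A, z₀) ≅ π₁(↥A', j z₀)`, `θ_B : π₁(↥B, z₀) ≅ π₁(↥B', j z₀)` (induced by the
homeomorphisms of `j` onto the images) with `(A' ⊆ B')_* ∘ θ_A = θ_B ∘ (A ⊆ B)_*` (Hatcher, §1.1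
p. 34: induced maps are functorial; Prop. 1.18: a homeomorphism induces an isomorphism).  The
target sets and base point are arguments (with equations) so that the isomorphisms land literally
in the prescribed fundamental groups. -/
private theorem exists_mulEquiv_inclHomOfSubset_comm_of_isEmbedding
    {Z X : Type*} [TopologicalSpace Z] [TopologicalSpace X] {j : Z → X} (hj : IsEmbedding j)
    {A B : Set Z} (hAB : A ⊆ B) {z₀ : Z} (hzA : z₀ ∈ A)
    {A' B' : Set X} (hA' : A' = j '' A) (hB' : B' = j '' B) (hA'B' : A' ⊆ B')
    {x₀ : X} (hx₀ : x₀ = j z₀) (hxA' : x₀ ∈ A') :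
    ∃ (θA : FundamentalGroup ↥A ⟨z₀, hzA⟩ ≃* FundamentalGroup ↥A' ⟨x₀, hxA'⟩)
      (θB : FundamentalGroup ↥B ⟨z₀, hAB hzA⟩ ≃* FundamentalGroup ↥B' ⟨x₀, hA'B' hxA'⟩),
      ∀ a, inclHomOfSubset hA'B' x₀ hxA' (hA'B' hxA') (θA a) =
        θB (inclHomOfSubset hAB z₀ hzA (hAB hzA) a) := by
  subst hA' hB' hx₀
  -- the homeomorphisms onto the images
  let ηA : ↥A ≃ₜ ↥(j '' A) := hj.homeomorphImage A
  let ηB : ↥B ≃ₜ ↥(j '' B) := hj.homeomorphImage B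
  have hηA : ηA ⟨z₀, hzA⟩ = ⟨j z₀, hxA'⟩ := Subtype.ext rfl
  have hηB : ηB ⟨z₀, hAB hzA⟩ = ⟨j z₀, hA'B' hxA'⟩ := Subtype.ext rfl
  refine ⟨fundamentalGroupEquivOfHomeomorph ηA hηA, fundamentalGroupEquivOfHomeomorph ηB hηB,
    fun a => ?_⟩
  rw [fundamentalGroupEquivOfHomeomorph_apply, fundamentalGroupEquivOfHomeomorph_apply]
  induction a using PushoutData.ind_fromPath with
  | h γ =>
    rw [inclHomOfSubset, inclHomOfSubset, _root_.FundamentalGroup.mapOfEq_apply,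
      _root_.FundamentalGroup.mapOfEq_apply, _root_.FundamentalGroup.mapOfEq_apply,
      _root_.FundamentalGroup.mapOfEq_apply]
    exact congrArg (fun p => _root_.FundamentalGroup.fromPath (Path.Homotopic.Quotient.mk p))
      (by ext t; rfl)

/-- **Transport of a chart-like cell of `Z` with a genus-`g` cell basis along `e : ↥F ≃ₜ Z`**
(registered stub `stub_cellBasisTransport` of line `lp-by-sphere-system-surgery`): for `F ⊆ X`
closed, a homeomorphism `e : ↥F ≃ₜ Z`, a chart-like cell `Ψ` of the whole space `Z` with open set
`OZ` and a genus-`g` cell basis, the cell `Ψ' = Subtype.val ∘ e.symm ∘ Ψ` is a chart-like cell in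
`F` for some open `O' ⊆ X` and carries a genus-`g` cell basis (the embedding
`Subtype.val ∘ e.symm` carries `Z ∖ Ψ(B(0,1)) ⊇ Ψ(‖z‖ = 1)` onto `F ∖ Ψ'(B(0,1)) ⊇ Ψ'(‖z‖ = 1)`
and induces isomorphisms on `π₁` commuting with the inclusions; Hatcher, *Algebraic Topology*
(2002), §1.1 p. 34 and Prop. 1.18). -/
theorem stub_cellBasisTransport {X : Type} [TopologicalSpace X] [T2Space X] {F : Set X}
    (hF : IsClosed F) {Z : Type} [TopologicalSpace Z] [T2Space Z] (e : ↥F ≃ₜ Z)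
    (Ψ : C(closedBall (0 : EuclideanSpace ℝ (Fin 2)) 2, Z)) (OZ : Set Z)
    (hc : IsChartCell (univ : Set Z) Ψ OZ) {g : ℕ} (hb : CellBasis (univ : Set Z) Ψ g) :
    ∃ (Ψ' : C(closedBall (0 : EuclideanSpace ℝ (Fin 2)) 2, X)) (O' : Set X),
      (∀ z, Ψ' z = (e.symm (Ψ z) : X)) ∧ IsChartCell F Ψ' O' ∧ CellBasis F Ψ' g := by
  -- `hF : IsClosed F` belongs to the registered signature; the transport does not need it
  obtain ⟨-⟩ := hF
  -- the embedding `j = Subtype.val ∘ e.symm : Z → X`, with range `F`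
  let j : Z → X := fun z => (e.symm z : X)
  have hj : IsEmbedding j := IsEmbedding.subtypeVal.comp e.symm.isEmbedding
  have hjF : ∀ z, j z ∈ F := fun z => (e.symm z).2
  have hrange : range j = F := by
    ext x
    constructor
    · rintro ⟨z, rfl⟩
      exact hjF z
    · intro hx
      exact ⟨e ⟨x, hx⟩, congrArg Subtype.val (e.symm_apply_apply ⟨x, hx⟩)⟩
  -- the transported cell
  let Ψ' : C(closedBall (0 : EuclideanSpace ℝ (Fin 2)) 2, X) :=
    ⟨fun z => j (Ψ z), hj.continuous.comp Ψ.continuous⟩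
  have himage : ∀ s : Set (closedBall (0 : EuclideanSpace ℝ (Fin 2)) 2),
      Ψ' '' s = j '' (Ψ '' s) := fun s => by
    rw [image_image]
    rfl
  obtain ⟨hinj, -, hO, hUO⟩ := hc
  -- the open set `O'` of `X` cutting out `e ⁻¹' OZ` on the subspace `F`
  obtain ⟨O', hO', hO'V⟩ := isOpen_induced_iff.mp (hO.preimage e.continuous)
  refine ⟨Ψ', O', fun _ => rfl, ⟨fun a b h => hinj (hj.injective h), ?_, hO', ?_⟩, ?_⟩
  · -- `range Ψ' ⊆ F`
    rintro _ ⟨z, rfl⟩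
    exact hjF _
  · -- `F ∩ O' = Ψ'(B(0,2))`
    have hval : Subtype.val '' (e ⁻¹' OZ) = j '' OZ := by
      ext x
      constructor
      · rintro ⟨y, hy, rfl⟩
        exact ⟨e y, hy, congrArg Subtype.val (e.symm_apply_apply y)⟩
      · rintro ⟨z, hz, rfl⟩
        exact ⟨e.symm z, show e (e.symm z) ∈ OZ by rw [e.apply_symm_apply]; exact hz, rfl⟩
    have hOZ : OZ = Ψ '' {z | ‖(z : EuclideanSpace ℝ (Fin 2))‖ < 2} := by
      rw [← hUO, univ_inter]
    calc F ∩ O' = Subtype.val '' (Subtype.val ⁻¹' O' : Set ↥F) :=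
          (Subtype.image_preimage_coe F O').symm
      _ = Subtype.val '' (e ⁻¹' OZ) := congrArg (fun s : Set ↥F => Subtype.val '' s) hO'V
      _ = j '' OZ := hval
      _ = j '' (Ψ '' {z | ‖(z : EuclideanSpace ℝ (Fin 2))‖ < 2}) := by rw [← hOZ]
      _ = Ψ' '' {z | ‖(z : EuclideanSpace ℝ (Fin 2))‖ < 2} := (himage _).symm
  · -- the cell basis
    obtain ⟨hpc, hx, hCA, t, θ, ht, hθ⟩ := hb
    have hHole : cellHole Ψ' = j '' cellHole Ψ := himage _
    have hCirc : cellCircle Ψ' = j '' cellCircle Ψ := himage _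
    have hDiff : F \ cellHole Ψ' = j '' (univ \ cellHole Ψ) := by
      rw [hHole, ← hrange, image_sdiff hj.injective, image_univ]
    have hx' : Ψ' cellPt ∈ cellCircle Ψ' := by
      rw [hCirc]
      exact mem_image_of_mem j hx
    have hCA' : cellCircle Ψ' ⊆ F \ cellHole Ψ' := by
      rw [hCirc, hDiff]
      exact image_mono hCA
    obtain ⟨θA, θB, hcomm⟩ := exists_mulEquiv_inclHomOfSubset_comm_of_isEmbedding hj hCA hx
      hCirc hDiff hCA' (rfl : Ψ' cellPt = j (Ψ cellPt)) hx'
    refine ⟨?_, hx', hCA', θA t, θ.trans θB, ?_, ?_⟩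
    · -- path-connectedness of `F ∖ Ψ'(B(0,1))`
      rw [hDiff]
      exact hpc.image hj.continuous
    · -- a group isomorphism maps a generator to a generator
      have hmap : Subgroup.closure {θA t} = (Subgroup.closure {t}).map θA.toMonoidHom := by
        rw [MonoidHom.map_closure, image_singleton, MulEquiv.coe_toMonoidHom]
      rw [hmap, ht, ← MonoidHom.range_eq_map, MonoidHom.range_eq_top]
      exact θA.surjective
    · -- `θ'(r_g) = incl' t'` by the naturality square
      rw [MulEquiv.trans_apply, hθ]
      exact (hcomm t).symm

end Summit.SmoothPoincare4.SmoothPoincare4.Cruxes.AgkCor6Sufficiency.LpBySphereSystemSurgery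

end
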